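import Literature.Algebra.Homology.DiscreteRepLayerColimitDesc
import Literature.Algebra.Homology.ExtPresentationBoundary
import HarnessLib

/-!
# Yoneda products `ŷ ∘ ∂_X(u)` of an inflated class with a presentation boundary, READ ON THE LAYER:
# `Inf_U(c) ∘ [S] ∘ u = Inf_U(u^U_* (δ_{S^U} c))` (Milne ADT I, proof of Thm. 4.10; Serre CG I §2.2 Prop. 8)

Topic `Algebra/Homology`; namespace `Literature.Algebra.Homology.DiscreteRep.LayerColimit`.  Sequel to door-c4's colimit
theorem (d) (`DiscreteRepLayerColimitGroupCohomology`: `inflG U M n : Hⁿ(Γ⧸U, M^U) →+ Extⁿ_{C_Γ}(k, M)`;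
`DiscreteRepLayerColimitDesc`: `desc`), `DiscreteRepLayerInflation` (`extInf_naturality`,
`mapExactFunctor_infFunctor_comp_extClass`) and door-c6 g16's F1 `ExtPresentationBoundary` (`boundary hS X u = [S] ∘ u`).
Theorems only (no definition, no named fact, no instance, no notation, no `sorry`).

THE POINT (the "E-side" of step (R4) of door-c6 g16's presentation road to Milne I 4.10, FINDING-door-c6-g16 §2/§5).  In the
proof of `Ker γ¹ ⊆ Im β¹` one pairs a class `ŷ ∈ Ext¹_{C_Γ}(k, N)` with the boundary `∂_X(u) = [S] ∘ u ∈ Ext¹_{C_Γ}(N, X)` of a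
homomorphism `u : N₁ → X` out of the kernel of a presentation `S : 0 → N₁ → P → N → 0`, and evaluates `inv (ŷ ∘ ∂_X(u))`.
By (d) `ŷ = Inf_U c` for a layer class `c ∈ Hⁿ(Γ⧸U, N^U)`; when the layer sequence `S^U : 0 → N₁^U → P^U → N^U → 0` is short
exact (e.g. `U` acts trivially on `P`, `shortExact_map_invariantsQuotFunctor`), the product is computed AT THE LAYER:

* `inflG_map` — `Inf_U` is natural in the module: `Inf_U (g^U_* c) = Inf_U c ∘ g`;
* **`inflG_comp_extClass`** — `Inf_U c ∘ [S] = Inf_U (δ_{S^U} c)` (`δ_{S^U}` Mathlib's connecting map of the layer sequence);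
* **`inflG_comp_boundary`** — `Inf_U c ∘ ∂_X(u) = Inf_U (u^U_* (δ_{S^U} c))`;
* `desc_inflG_comp_boundary` — hence for an `inv` descended from a compatible family `f` of layer maps,
  `inv (Inf_U c ∘ ∂_X(u)) = f_i (Inf_{U → V_i} (u^U_* (δ_{S^U} c)))`.

For the idèle class formation (`inv = classBarInv`, `f_E = inv_{E/F} ∘ iso_E`) this is the finite-layer expression
`inv_{E/F}((u_E)_* δ c)` of door-c6 g16's FINDING §2 (sequel, `NumberTheory/GaloisRepresentations`).

HONEST FRAMING: homological algebra only; no arithmetic, no case of BSD or of Poitou–Tate.  Route A of crux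
`AnticycControlAdditiveK` (item 19295, cell bsd-schneider), seat door-c4 gen 17.

## References
* J. S. Milne, *Arithmetic Duality Theorems* (2nd ed. 2006), I §4, proof of Theorem 4.10 (p. 58); I §0 (0.8). [MilneADT2006]
* J.-P. Serre, *Galois Cohomology* (1997), I §2.2 Proposition 8. [SerreGaloisCohomology1997]
* C. A. Weibel, *An introduction to homological algebra* (1994), §2.7. [Weibel1994]
-/

noncomputable section

universe u

namespace Literature.Algebra.Homology

namespace DiscreteRep

open CategoryTheory CategoryTheory.Limits CategoryTheory.Abelian groupCohomology

variable {k Γ : Type u} [CommRing k] [Group Γ] [TopologicalSpace Γ] [IsTopologicalGroup Γ]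

/-! ## §1 The layer sequence of a short exact sequence with `U`-trivial middle term -/

/-- **`0 → X₁^U → X₂^U → X₃^U → 0` is short exact when `U` acts trivially on `X₂`** (for `S : 0 → X₁ → X₂ → X₃ → 0`
short exact in `C_Γ`): a `U`-invariant of `X₃` lifts to `X₂ = X₂^U`, and a vector of `X₁` mapping into `X₂^U` is
`U`-invariant (`X₁ → X₂` injective).  E.g. door-c4's free presentation `0 → N₁ → Inf ℤ[Γ/U]ᵐ → N → 0`.
[cite: MilneADT2006, I §0 (0.8)][cite: Weibel1994, §2.7] -/
theorem shortExact_map_invariantsQuotFunctor (U : Subgroup Γ) [U.Normal] {S : ShortComplex (DiscreteRepCat k Γ)}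
    (hS : S.ShortExact) (h₂ : ∀ (u : U) (x : S.X₂.obj.V), S.X₂.obj.ρ (u : Γ) x = x) :
    (S.map (invariantsQuotFunctor k U)).ShortExact := by
  haveI := hS.mono_f
  haveI := hS.epi_g
  have hinj : Function.Injective S.f.hom.hom := (Rep.mono_iff_injective ((ι k Γ).map S.f)).1 inferInstance
  have hsurj : Function.Surjective S.g.hom.hom := (Rep.epi_iff_surjective ((ι k Γ).map S.g)).1 inferInstance
  have hex : ∀ x₂ : S.X₂.obj.V, S.g.hom.hom x₂ = 0 → ∃ x₁ : S.X₁.obj.V, S.f.hom.hom x₁ = x₂ := by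
    haveI : (ι k Γ).PreservesHomology :=
      ⟨fun _ _ f => (isDiscrete k Γ).preservesKernels_ι f, fun _ _ f => (isDiscrete k Γ).preservesCokernels_ι f⟩
    have h := hS.exact
    rw [← ShortComplex.exact_map_iff_of_faithful _ (ι k Γ),
      ← ShortComplex.exact_map_iff_of_faithful _ (forget₂ (Rep.{u} k Γ) (ModuleCat.{u} k)),
      ShortComplex.moduleCat_exact_iff] at h
    intro x₂ hx₂
    obtain ⟨x₁, hx₁⟩ := h x₂ hx₂
    exact ⟨x₁, hx₁⟩
  refine { exact := ?_, mono_f := ?_, epi_g := ?_ }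
  · refine LayerColimit.rep_exact_of_forall _ _ _ fun x hx => ?_
    have hx' : S.g.hom.hom x.1 = 0 := congrArg Subtype.val hx
    obtain ⟨x₁, hx₁⟩ := hex x.1 hx'
    refine ⟨⟨x₁, fun u => hinj ?_⟩, Subtype.ext hx₁⟩
    change S.f.hom.hom (S.X₁.obj.ρ (U.subtype u) x₁) = S.f.hom.hom x₁
    rw [Rep.hom_comm_apply, hx₁]
    exact x.2 u
  · exact (Rep.mono_iff_injective _).2 fun x y h => Subtype.ext (hinj (congrArg Subtype.val h))
  · refine (Rep.epi_iff_surjective _).2 fun y => ?_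
    obtain ⟨x₂, hx₂⟩ := hsurj y.1
    exact ⟨⟨x₂, fun u => h₂ u x₂⟩, Subtype.ext hx₂⟩

namespace LayerColimit

variable (U : OpenNormalSubgroup Γ)

/-! ## §2 `Inf_U` is natural in the module -/

/-- **`Inf_U (g^U_* c) = Inf_U c ∘ g`**: door-c4's inflation `inflG U` is natural in the module (`extInf_naturality` under
the dictionary `E`). [cite: SerreGaloisCohomology1997, I §2.2 Proposition 8] -/
theorem inflG_map {M M' : DiscreteRepCat k Γ} (g : M ⟶ M') (n : ℕ)
    (c : groupCohomology ((invariantsQuotFunctor k (U : Subgroup Γ)).obj M) n) :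
    inflG U M' n ((groupCohomology.map (MonoidHom.id _) ((invariantsQuotFunctor k (U : Subgroup Γ)).map g) n).hom c) =
      (inflG U M n c).comp (Ext.mk₀ g) (add_zero n) := by
  rw [inflG_apply, inflG_apply, RepExt.extTrivialAddEquivGroupCohomology_symm_naturality]
  exact extInf_naturality (U : Subgroup Γ) (coe_isOpen U) g n _

/-! ## §3 `Inf_U c ∘ [S]` and `Inf_U c ∘ ∂_X(u)` on the layer -/

variable {S : ShortComplex (DiscreteRepCat k Γ)} (hS : S.ShortExact)
  (hSU : (S.map (invariantsQuotFunctor k (U : Subgroup Γ))).ShortExact)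

/-- **`Inf_U c ∘ [S] = Inf_U (δ_{S^U} c)`**: the Yoneda product of a class inflated from the layer `U` with the class of
`S` is inflated from the connecting image of `c` under the (short exact) layer sequence `S^U` (`E` intertwines `δ` and
`∘ [S^U]`; `Inf` intertwines `[S^U]` and `[S]` along the inclusions `Inf(Xᵢ^U) ⊆ Xᵢ`).
[cite: MilneADT2006, I §4, proof of Theorem 4.10][cite: SerreGaloisCohomology1997, I §2.2 Proposition 8] -/
theorem inflG_comp_extClass (n : ℕ) (c : groupCohomology ((invariantsQuotFunctor k (U : Subgroup Γ)).obj S.X₃) n) :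
    (inflG U S.X₃ n c).comp hS.extClass (rfl : n + 1 = n + 1) =
      inflG U S.X₁ (n + 1) ((groupCohomology.δ hSU n (n + 1) rfl).hom c) := by
  -- the dictionary `E` intertwines `δ_{S^U}` and `∘ [S^U]`
  have h1 : (layerE U S.X₁ (n + 1)).symm ((groupCohomology.δ hSU n (n + 1) rfl).hom c) =
      ((layerE U S.X₃ n).symm c).comp hSU.extClass (rfl : n + 1 = n + 1) := by
    apply (layerE U S.X₁ (n + 1)).injective
    refine ((layerE U S.X₁ (n + 1)).apply_symm_apply _).trans
      (Eq.trans ?_ (RepExt.extTrivialAddEquivGroupCohomology_comp_extClass' hSU n ((layerE U S.X₃ n).symm c)).symm)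
    exact congrArg (fun z => (groupCohomology.δ hSU n (n + 1) rfl).hom z) ((layerE U S.X₃ n).apply_symm_apply c).symm
  -- `Inf` along the inclusions `Inf(Xᵢ^U) ⊆ Xᵢ`
  let φ : (S.map (invariantsQuotFunctor k (U : Subgroup Γ))).map (infFunctor k (U : Subgroup Γ) (coe_isOpen U)) ⟶ S :=
    { τ₁ := invariantsIncl (U : Subgroup Γ) (coe_isOpen U) S.X₁
      τ₂ := invariantsIncl (U : Subgroup Γ) (coe_isOpen U) S.X₂
      τ₃ := invariantsIncl (U : Subgroup Γ) (coe_isOpen U) S.X₃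
      comm₁₂ := infFunctor_map_invariantsIncl (U : Subgroup Γ) (coe_isOpen U) S.f
      comm₂₃ := infFunctor_map_invariantsIncl (U : Subgroup Γ) (coe_isOpen U) S.g }
  have h2 := mapExactFunctor_infFunctor_comp_extClass (U : Subgroup Γ) (coe_isOpen U) hSU hS φ
    ((layerE U S.X₃ n).symm c)
  rw [inflG_apply, inflG_apply, h1]
  exact h2

/-- **`Inf_U c ∘ ∂_X(u) = Inf_U (u^U_* (δ_{S^U} c))`**: the Yoneda product with the boundary `∂_X(u) = [S] ∘ u` of a
homomorphism `u : X₁ → X` (door-c6 `ExtPresentation.boundary`) is inflated from the layer class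
`Hⁿ⁺¹(id, u^U) (δ_{S^U} c) ∈ Hⁿ⁺¹(Γ⧸U, X^U)`. [cite: MilneADT2006, I §4, proof of Theorem 4.10][cite: Weibel1994, §2.7] -/
theorem inflG_comp_boundary {X : DiscreteRepCat k Γ} (n : ℕ)
    (c : groupCohomology ((invariantsQuotFunctor k (U : Subgroup Γ)).obj S.X₃) n) (u : S.X₁ ⟶ X) :
    (inflG U S.X₃ n c).comp (ExtPresentation.boundary hS X u) (rfl : n + 1 = n + 1) =
      inflG U X (n + 1) ((groupCohomology.map (MonoidHom.id _)
        ((invariantsQuotFunctor k (U : Subgroup Γ)).map u) (n + 1)).hom ((groupCohomology.δ hSU n (n + 1) rfl).hom c)) :=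
  calc (inflG U S.X₃ n c).comp (ExtPresentation.boundary hS X u) (rfl : n + 1 = n + 1)
      = ((inflG U S.X₃ n c).comp hS.extClass (rfl : n + 1 = n + 1)).comp (Ext.mk₀ u) (add_zero (n + 1)) :=
        ExtPresentation.comp_boundary hS _ u
    _ = (inflG U S.X₁ (n + 1) ((groupCohomology.δ hSU n (n + 1) rfl).hom c)).comp (Ext.mk₀ u) (add_zero (n + 1)) := by
        rw [inflG_comp_extClass U hS hSU]
    _ = _ := (inflG_map U u (n + 1) ((groupCohomology.δ hSU n (n + 1) rfl).hom c)).symm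

/-- **`inv (Inf_U c ∘ ∂_X(u)) = f_i (Inf_{U → V_i} (u^U_* (δ_{S^U} c)))`** for an `inv : Extⁿ⁺¹_{C_Γ}(k, X) →+ A` descended
from a compatible family `f` of layer maps (door-c4 `LayerColimit.desc`) and any member `V_i ≤ U` of the family.
[cite: MilneADT2006, I §4, proof of Theorem 4.10][cite: SerreGaloisCohomology1997, I §2.2 Proposition 8] -/
theorem desc_inflG_comp_boundary [CompactSpace Γ] [TotallyDisconnectedSpace Γ] {X : DiscreteRepCat k Γ} (n : ℕ)
    {ι : Type*} {W : ι → OpenNormalSubgroup Γ} {A : Type*} [AddCommGroup A]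
    {f : ∀ i, groupCohomology ((invariantsQuotFunctor k (W i : Subgroup Γ)).obj X) (n + 1) →+ A}
    (hf : IsCompatibleFamily W X (n + 1) f) {i : ι} (hi : (W i : Subgroup Γ) ≤ U)
    (c : groupCohomology ((invariantsQuotFunctor k (U : Subgroup Γ)).obj S.X₃) n) (u : S.X₁ ⟶ X) :
    desc W X (n + 1) f hf ((inflG U S.X₃ n c).comp (ExtPresentation.boundary hS X u) (rfl : n + 1 = n + 1)) =
      f i (stepG U (W i) hi X (n + 1) ((groupCohomology.map (MonoidHom.id _)
        ((invariantsQuotFunctor k (U : Subgroup Γ)).map u) (n + 1)).hom ((groupCohomology.δ hSU n (n + 1) rfl).hom c))) :=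
  (congrArg (desc W X (n + 1) f hf) (inflG_comp_boundary U hS hSU n c u)).trans (desc_inflG_of_le hf U hi _)

end LayerColimit

end DiscreteRep

end Literature.Algebra.Homology

end
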